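import Summits.BirchSwinnertonDyer.BirchSwinnertonDyer.Theorems.GoldfeldAllTwistsTwoConverseTwinGenusOddMultiple
import Summits.BirchSwinnertonDyer.BirchSwinnertonDyer.Theorems.GoldfeldAllTwistsTwoConverseTwinGenusFieldDescent
import HarnessLib

set_option linter.dupNamespace false
set_option autoImplicit false

/-!
# LINE B49, genus assembly G5b-(R) — the witnesses of the genus-point input `X049GenusPointOddMultiple`
# from a conductor-one Heegner datum over a Galois extension `L/K` containing `√q`: the rationality
# half is REDUCED to the trace relation and THEOREM A in Galois-sum currency

Cell `bsd-goldfeld`, seat `bsd-goldfeld-s1p-c3` (prover, gen 6); TARGET v5.2 §2 c3 (e). Support for item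
`stmt-BirchSwinnertonDyer-19140` (crux twin″ `Theses.GoldfeldAllTwistsTwoConverse.BSDTwoCMSevenAdditiveRankOne`;
joint with 20044). Clean cone (no Theses import). HONEST FRAMING: nothing about BSD or `L`-values is
asserted; this file shows that the `∃`-clause of the named input `X049GenusPointOddMultiple` (seat s1p-c3 gen 6,
`…TwinGenusOddMultiple`) at `(q, K, P)` FOLLOWS from data of the kind the tree's Heegner-point / CM files and
cell `bsd-uniform`'s track U2 produce:
* a finite Galois extension `L/K` (`K` imaginary quadratic, `d_K = −4q`; intended `L = K[1] ⊂ ℂ`, the Hilbert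
  class field) with an element `r₀ ∈ L`, `r₀² = q` (for `L = K[1]`: `sqrt_mem_ringClassField_one_of_discr_eq`,
  `RingClassFieldGenusDiscriminantProofs`, Cox Thm. 6.1);
* a point `y₁ ∈ X₀(49)(L)` (intended: the conductor-one Heegner point) and the TRACE RELATION
  `P = n • Σ_{σ ∈ Gal(L/K)} σ y₁` in `X₀(49)(L)`, `n ≠ 0` (Shimura reciprocity / Gross 1991 (4.1); in the
  tree the binder `hyK` of `Uniform/U2/GenusPointRingClass`, or `IsAutEquivariantOnHeegner`);
* THEOREM A in Galois-sum currency: for a square root `i ∈ L` of `−1`, some multiple of the genus point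
  `y_χ = Σ_σ χ(σ)•σ y₁` (`χ` the quadratic character of `r₀`) is an ODD multiple of `(0, i)` modulo torsion.
Given these, the witnesses are: `H₀ = K⟮r₀⟯` (`= K(i)`, degree `2` over `K` since `q` is not a square in
`K`), `i₀ = i ∈ K⟮r₀⟯` (`i = ±√d_K·r₀/(2q)`), `y` = the `K`-rational trace (Galois descent), `y_χ`, `Z` = the
twisted trace and the genus half-trace DESCENDED to `K⟮r₀⟯` (`…TwinGenusFieldDescent`), with the genus
identity `y − y_χ = 2•Z` and Theorem A transported along the injection `X₀(49)(K⟮r₀⟯) ↪ X₀(49)(L)`.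

* `genusPointOddMultiple_witness` — the reduction at one `(q, K, P)`;
* `x049GenusPointOddMultiple_of_galoisData` — `X049GenusPointOddMultiple` from such data for all `(q, K, P)`.

References: B. Gross (1984) §§4–5 [Gross1984]; B. Gross (1991) §4 (4.1) [GrossLMS1991]; J. Coates, Y. Li, Y. Tian,
S. Zhai, PLMS 110 (2015) Thm. 2.5, (2.8) [CoatesLiTianZhai2015]; D. A. Cox (2013) Thm. 6.1 [Cox2013].
-/

noncomputable section

open scoped Classical IntermediateField

open WeierstrassCurve Literature.NumberTheory.EllipticCurves
  Literature.NumberTheory.EllipticCurves.ModularForms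

namespace Summit.BirchSwinnertonDyer.BirchSwinnertonDyer.Theorems.GoldfeldGoodTwists

/-! ## §1 Plumbing: `Point.map` only depends on the underlying function -/

section Plumbing

variable {F₁ F₂ : Type*} [Field F₁] [Field F₂] [Algebra ℚ F₁] [Algebra ℚ F₂] {W : WeierstrassCurve ℚ}

/-- Two `ℚ`-algebra maps with the same underlying function induce the same map on points. [folklore] -/
theorem point_map_congr (f g : F₁ →ₐ[ℚ] F₂) (h : ∀ x, f x = g x) (P : (W.baseChange F₁).toAffine.Point) :
    Affine.Point.map f P = Affine.Point.map g P := by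
  rcases P with _ | ⟨x, y, hxy⟩
  · rfl
  · rw [Affine.Point.map_some, Affine.Point.map_some]
    simp only [h]

end Plumbing

/-! ## §2 The witnesses of `X049GenusPointOddMultiple` from a Galois datum -/

variable {K : Type} [Field K] [NumberField K]

/-- `q` is not a square in `K = ℚ(√−q)` (`d_K = −4q`, `q` prime): else `q` or `q·d_K = −4q² < 0` would be a
rational square. [folklore] -/
theorem not_isSquare_natCast_of_discr_eq (hK : IsImaginaryQuadratic K) {q : ℕ} (hq : q.Prime)
    (hdK : NumberField.discr K = -(4 * (q : ℤ))) : ¬ IsSquare ((q : ℕ) : K) := by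
  intro h
  have h' : IsSquare (algebraMap ℚ K (q : ℚ)) := by rwa [map_natCast]
  rcases isSquare_or_of_isSquare_algebraMap_rat hK h' with h1 | h1
  · exact not_isSquare_prime hq (Rat.isSquare_natCast_iff.mp h1)
  · refine not_isSquare_of_neg ?_ h1
    rw [hdK]; push_cast
    have : (0 : ℚ) < q := by exact_mod_cast hq.pos
    nlinarith

/-- **THE WITNESSES OF THE GENUS-POINT INPUT FROM A GALOIS DATUM.** Let `q` be a prime with `(q/7) = −1`,
`K` imaginary quadratic with `d_K = −4q`, `P ∈ X₀(49)(K)`; let `L/K` be finite Galois with `r₀ ∈ L`,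
`r₀² = q`, and `y₁ ∈ X₀(49)(L)` with the TRACE RELATION `P = n • Σ_{σ ∈ Gal(L/K)} σ y₁` (`n ≠ 0`); assume
THEOREM A in Galois-sum currency: for some square root `i ∈ L` of `−1` on the curve (`(0, i) ∈ X₀(49)(L)`)
and integers `μ`, `λ` odd, `μ • Σ_σ χ(σ)•σ y₁ − λ • (0, i)` is torsion, `χ(σ) = ±1` according as
`σ r₀ = ±r₀`. Then the `∃`-clause of `X049GenusPointOddMultiple` holds at `(q, K, P)` with `H₀ = K⟮r₀⟯`.
[cite: Gross1984, §§4–5] [cite: CoatesLiTianZhai2015, Thm. 2.5 and (2.8)] [cite: Cox2013, §6.A Thm. 6.1] -/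
theorem genusPointOddMultiple_witness (hK : IsImaginaryQuadratic K) {q : ℕ} (hq : q.Prime)
    (hdK : NumberField.discr K = -(4 * (q : ℤ))) (P : (cm7.baseChange K).toAffine.Point)
    {L : Type} [Field L] [CharZero L] [Algebra K L] [FiniteDimensional K L] [IsGalois K L]
    {r₀ : L} (hr : r₀ ^ 2 = algebraMap K L ((q : ℕ) : K))
    (y₁ : (cm7.baseChange L).toAffine.Point) {n : ℤ} (hn : n ≠ 0)
    (htr : Affine.Point.map (algebraMap K L).toRatAlgHom P =
      n • ∑ σ : L ≃ₐ[K] L, Affine.Point.map (σ : L →ₐ[K] L) y₁)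
    (hA : ∃ (i : L) (hi : (cm7.baseChange L).toAffine.Nonsingular 0 i) (μ l : ℤ), Odd l ∧
      IsOfFinAddOrder (μ • (∑ σ : L ≃ₐ[K] L, (if σ r₀ = r₀ then (1 : ℤ) else -1) •
        Affine.Point.map (σ : L →ₐ[K] L) y₁) - l • Affine.Point.some 0 i hi)) :
    ∃ (H₀ : Type) (_ : Field H₀) (_ : CharZero H₀) (_ : Algebra K H₀) (i₀ : H₀)
      (hg : (cm7.baseChange H₀).toAffine.Nonsingular 0 i₀)
      (y yχ Z : (cm7.baseChange H₀).toAffine.Point) (n μ l : ℤ),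
      Module.finrank K H₀ = 2 ∧ n ≠ 0 ∧ Odd l ∧
      Affine.Point.map (algebraMap K H₀).toRatAlgHom P = n • y ∧
      IsOfFinAddOrder (y - yχ - (2 : ℤ) • Z) ∧
      IsOfFinAddOrder (μ • yχ - l • Affine.Point.some 0 i₀ hg) := by
  obtain ⟨i, hi, μ, l, hl, hAt⟩ := hA
  -- the genus field `H₀ = K⟮r₀⟯`
  have hqK : ¬ IsSquare ((q : ℕ) : K) := not_isSquare_natCast_of_discr_eq hK hq hdK
  have hfin : Module.finrank K K⟮r₀⟯ = 2 := finrank_adjoin_sqrt_eq_two (L := L) hr hqK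
  -- the three maps
  set fKL : (cm7.baseChange K).toAffine.Point →+ (cm7.baseChange L).toAffine.Point :=
    Affine.Point.map (W' := cm7) (algebraMap K L).toRatAlgHom with hfKL
  set fKH : (cm7.baseChange K).toAffine.Point →+ (cm7.baseChange K⟮r₀⟯).toAffine.Point :=
    Affine.Point.map (W' := cm7) (algebraMap K K⟮r₀⟯).toRatAlgHom with hfKH
  set fHL : (cm7.baseChange K⟮r₀⟯).toAffine.Point →+ (cm7.baseChange L).toAffine.Point :=
    Affine.Point.map (W' := cm7) (algebraMap K⟮r₀⟯ L).toRatAlgHom with hfHL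
  have hcomp : ∀ Q : (cm7.baseChange K).toAffine.Point, fHL (fKH Q) = fKL Q := by
    intro Q
    rw [hfHL, hfKH, Affine.Point.map_map]
    exact point_map_congr _ _ (fun x => (IsScalarTower.algebraMap_apply K K⟮r₀⟯ L x).symm) Q
  have hinjHL : Function.Injective fHL :=
    Affine.Point.map_injective (W' := cm7) ((algebraMap K⟮r₀⟯ L).toRatAlgHom)
  -- `i ∈ K⟮r₀⟯`: `i = ± δ r₀ / (2q)` with `δ² = d_K = −4q` in `K`
  obtain ⟨δ, hδ, -, -⟩ := exists_sq_eq_discr_and_span hK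
  have hδ2 : (algebraMap K L δ) ^ 2 = -(4 * (q : L)) := by
    rw [← map_pow, hδ, hdK]
    simp [map_neg, map_mul, map_ofNat, map_natCast]
  have hi2 : i ^ 2 = -1 := sq_eq_neg_one_of_nonsingular_zero hi
  have hq0 : (q : L) ≠ 0 := by exact_mod_cast hq.ne_zero
  have hr' : r₀ ^ 2 = (q : L) := by rw [hr, map_natCast]
  have hw2 : (algebraMap K L δ * r₀ / (2 * q)) ^ 2 = -1 := by
    rw [div_pow, mul_pow, hδ2, hr']
    field_simp
    ring
  have hi_mem : i ∈ K⟮r₀⟯ := by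
    have hw_mem : algebraMap K L δ * r₀ / (2 * q) ∈ K⟮r₀⟯ := by
      refine div_mem (mul_mem (IntermediateField.algebraMap_mem _ δ)
        (IntermediateField.mem_adjoin_simple_self K r₀)) ?_
      exact_mod_cast (natCast_mem K⟮r₀⟯ (2 * q))
    rcases sq_eq_sq_iff_eq_or_eq_neg.mp (hi2.trans hw2.symm) with h | h
    · rw [h]; exact hw_mem
    · rw [h]; exact neg_mem hw_mem
  set i₀ : K⟮r₀⟯ := ⟨i, hi_mem⟩ with hi₀
  have hi₀2 : i₀ ^ 2 = -1 := by
    apply Subtype.ext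
    simpa using hi2
  have hg : (cm7.baseChange K⟮r₀⟯).toAffine.Nonsingular 0 i₀ := by
    refine (Affine.equation_iff_nonsingular).mp ?_
    rw [Affine.equation_iff]
    simp [baseChange]
    linear_combination hi₀2
  have hgi : fHL (Affine.Point.some 0 i₀ hg) = Affine.Point.some 0 i hi := by
    rw [hfHL, Affine.Point.map_some]
    rfl
  -- the trace is `Gal(L/K)`-fixed, hence `K`-rational: `P = n • P_K`
  set T : (cm7.baseChange L).toAffine.Point := ∑ σ : L ≃ₐ[K] L, Affine.Point.map (σ : L →ₐ[K] L) y₁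
    with hT
  have hT' : T = ∑ σ : L ≃ₐ[K] L, (1 : ℤ) • Affine.Point.map (σ : L →ₐ[K] L) y₁ := by
    simp only [one_zsmul]; rfl
  obtain ⟨PK, hPK⟩ : ∃ PK : (cm7.baseChange K).toAffine.Point, fKL PK = T := by
    refine exists_map_eq_of_forall_map_galois_eq cm7 (k := K) fun τ => ?_
    rw [hT']
    exact map_sum_smul_map_eq_of_invariant cm7 τ (fun _ => (1 : ℤ)) (fun _ => rfl) y₁
  have hPn : P = n • PK := by
    apply Affine.Point.map_injective (W' := cm7) (f := (algebraMap K L).toRatAlgHom)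
    rw [map_zsmul]
    change fKL P = n • fKL PK
    rw [hPK, ← htr]
  -- descend the twisted trace and the genus half-trace to `K⟮r₀⟯`
  obtain ⟨yχ, hyχ⟩ := exists_map_adjoin_eq_twistedSum cm7 (k := K) hr y₁
  obtain ⟨Z, hZ⟩ := exists_map_adjoin_eq_genusHalfSum cm7 (k := K) hr y₁ 0 1
  -- the three conclusions, in the instance world of this file; transported by `convert` at the end
  have h1 : fKH P = n • fKH PK := by rw [hPn, map_zsmul]
  have h2 : IsOfFinAddOrder (fKH PK - yχ - (2 : ℤ) • Z) := by
    have h0 : fKH PK - yχ - (2 : ℤ) • Z = 0 := by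
      apply hinjHL
      rw [map_sub, map_sub, map_zsmul, map_zero, hcomp, hPK]
      change T - fHL yχ - (2 : ℤ) • fHL Z = 0
      rw [hfHL, hyχ, hZ, hT, sum_map_sub_twistedSum_eq_two_smul cm7 r₀ y₁, sub_self]
    rw [h0]
    exact IsOfFinAddOrder.zero
  have h3 : IsOfFinAddOrder (μ • yχ - l • Affine.Point.some 0 i₀ hg) := by
    refine (hinjHL.isOfFinAddOrder_iff (f := fHL)).mp ?_
    rw [map_sub, map_zsmul, map_zsmul, hgi, hfHL, hyχ]
    exact hAt
  refine ⟨K⟮r₀⟯, inferInstance, inferInstance, inferInstance, i₀, hg, fKH PK, yχ, Z, n, μ, l, hfin, hn, hl,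
    ?_, ?_, ?_⟩
  · convert h1
  · convert h2
  · convert h3

/-- **`X049GenusPointOddMultiple` from Galois data for every `(q, K, P)`**: if for every prime `q` with
`(q/7) = −1`, every imaginary quadratic `K` with `d_K = −4q` and every level-`49` Heegner point
`P ∈ X₀(49)(K)` there are a finite Galois `L/K` containing `√q`, a point `y₁ ∈ X₀(49)(L)` with the trace
relation `P = n • Σ_σ σ y₁` (`n ≠ 0`) and Theorem A in Galois-sum currency, then the genus-point input holds
(hence clause (i) of the even-discriminant Birch lemma for all `q`, `…TwinGenusOddMultiple`). This splits the
input into the cell's (R) data (Shimura reciprocity over `K[1]` + `√q ∈ K[1]`) and (A) (explicit Gross–Zagier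
for `χ`, CLTZ Thm 1.2, BSD₂ of the `784`-partner). [cite: Gross1984, §§4–5] [cite: CoatesLiTianZhai2015, Thm. 2.5 and (2.8)] -/
theorem x049GenusPointOddMultiple_of_galoisData
    (h : ∀ (q : ℕ) (K : Type) [Field K] [NumberField K] (P : (cm7.baseChange K).toAffine.Point),
      q.Prime → jacobiSym q 7 = -1 → IsImaginaryQuadratic K → NumberField.discr K = -(4 * (q : ℤ)) →
      IsHeegnerPoint 49 cm7 K P →
      ∃ (L : Type) (_ : Field L) (_ : CharZero L) (_ : Algebra K L) (_ : FiniteDimensional K L)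
        (_ : IsGalois K L) (r₀ : L) (y₁ : (cm7.baseChange L).toAffine.Point) (n : ℤ),
        r₀ ^ 2 = algebraMap K L ((q : ℕ) : K) ∧ n ≠ 0 ∧
        Affine.Point.map (algebraMap K L).toRatAlgHom P =
          n • ∑ σ : L ≃ₐ[K] L, Affine.Point.map (σ : L →ₐ[K] L) y₁ ∧
        ∃ (i : L) (hi : (cm7.baseChange L).toAffine.Nonsingular 0 i) (μ l : ℤ), Odd l ∧
          IsOfFinAddOrder (μ • (∑ σ : L ≃ₐ[K] L, (if σ r₀ = r₀ then (1 : ℤ) else -1) •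
            Affine.Point.map (σ : L →ₐ[K] L) y₁) - l • Affine.Point.some 0 i hi)) :
    X049GenusPointOddMultiple := by
  intro q K _ _ P hq hq7 hK hdK hP
  obtain ⟨L, _, _, _, _, _, r₀, y₁, n, hr, hn, htr, hA⟩ := h q K P hq hq7 hK hdK hP
  exact genusPointOddMultiple_witness hK hq hdK P hr y₁ hn htr hA

end Summit.BirchSwinnertonDyer.BirchSwinnertonDyer.Theorems.GoldfeldGoodTwists

end
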